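import Mathlib
import Literature.Analysis.PDE.ParabolicMaximumPrinciple1D
import Literature.Analysis.FluidPDE.ChoiEtAl2017PeriodicHouLuoKernel
import Literature.Analysis.FluidPDE.ChoiEtAl2017PeriodicHouLuoVelocity
import HarnessLib

/-!
# Choi–Hou–Kiselev–Luo–Šverák–Yao 2017, §4: the sign structure is preserved on the half period
# — `θ_x, ω ≥ 0` on `[0, ½L]` persist for symmetric classical solutions of the periodic Hou–Luo model

HONEST FRAMING (cell ns-blowup GROUP B «PROFILE SEARCH», zones Z3-b′ / Z8 = the Hou–Luo boundary
MODEL): **1-D MODEL (Hou–Luo), not Euler/NS.** Proof-only companion of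
`ChoiEtAl2017PeriodicHouLuoBlowup.lean` / `…Kernel.lean` / `…Velocity.lean`. Source:

* K. Choi, T. Y. Hou, A. Kiselev, G. Luo, V. Šverák, Y. Yao, Comm. Pure Appl. Math. **70** (2017)
  2218–2243 = arXiv:1407.4776 [ChoiHouKiselevLuoSverakYao2017], §4 p. 11 (held text
  `paper:arxiv-1407.4776`): "we consider smooth odd periodic initial data `θ_{0x}, ω₀` with period
  `L` … we suppose `θ_{0x}, ω₀ ≥ 0` on `[0, ½L]` … **Thanks to transport structure of (hl), the
  evolution preserves the assumptions as long as the solution exists. That is, `θ_x, ω, u` stay odd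
  at `x = 0` and `½L` with period `L`, `θ(0) = 0`, and `θ_x, ω, (−u) ≥ 0` on `[0, ½L]`.**"

This file kernel-checks the SIGN half of that sentence for solutions that keep the symmetry (the
symmetry half is a uniqueness statement, stage [C] of the discharge plan): stage [D] of the
discharge of `choiEtAl2017_periodicHouLuo_blowup`.

## What is proved (no definitions of Prop type, no named facts; net debt 0)

* `nonneg_of_transport_supersolution` — a generic one-dimensional TRANSPORT sign lemma on a
  rectangle `[0,T] × [a,b]`: if `v` is continuous, `v_t + b v_x + c v ≥ 0` inside with `c`
  bounded below, and `v ≥ 0` on the parabolic boundary (`t = 0`, `x = a`, `x = b`), then `v ≥ 0`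
  — the tree's weak maximum principle `Literature.Analysis.PDE.nonpos_of_parabolic_subsolution_1d`
  (Lieberman Lemma 2.1/2.3, diffusion coefficient `A = 0` allowed) applied to `w = −e^{−Λt}v`.
* `deriv_theta_nonneg_of_symmetric` — for a classical periodic HL solution whose slices stay odd
  (`ω(t)`, `θ_x(t)` odd and `L`-periodic) and whose `θ_x` satisfies the differentiated transport
  equation `(θ_x)_t = −(u θ_xx + u_x θ_x)` (supplied from joint smoothness in the assembly stage),
  `θ_{0x} ≥ 0` on `[0, ½L]` ⇒ `θ_x(t) ≥ 0` on `[0, ½L]` for all `t`.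
* `omega_nonneg_of_symmetric` — under the same symmetry, `ω_t + uω_x = θ_x ≥ 0` and `ω₀ ≥ 0` on
  `[0, ½L]` ⇒ `ω(t) ≥ 0` on `[0, ½L]`.
* `periodicHLVelocity_nonpos_of_symmetric` — hence `u(t) = Qω(t) ≤ 0` on `[0, ½L]` for all `t`
  (with `ChoiEtAl2017.periodicHLVelocity_nonpos` of `…Kernel.lean`): the compressive inflow towards
  the origin persists — the mechanism sentence of the printed scenario ("`θ` will be pushed towards
  the origin by the flow", Do–Kiselev–Xu's gloss of the same proof).

* `hasDerivAt_deriv_theta` — the differentiated transport equation `(θ_x)_t = −(u θ_xx + u_x θ_x)`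
  DERIVED from joint `C²` smoothness on the open strip (symmetry of second derivatives,
  `ContDiffAt.isSymmSndFDerivAt`, and `u ∈ C¹` with `u_x = Q(ω_x)`); file-private plumbing
  (`continuousOn_deriv_slice`, `contDiff_slice`, `exists_bound_deriv_slice`) — joint continuity of
  `θ_x` up to `t = 0`, smooth slices and a uniform bound on `ω_x` from joint smoothness on the closed
  half-plane `{t ≥ 0}`.
* **`sign_persistence_of_symmetric`** — the assembled statement: a classical periodic HL solution,
  jointly `C^∞` on `{t ≥ 0}` (the smoothness clause of `IsGlobalSmoothPeriodicHouLuoSolution`) whose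
  slices stay odd, launched from `θ_{0x}, ω₀ ≥ 0` on `[0, ½L]`, keeps `θ_x ≥ 0`, `ω ≥ 0`, `u ≤ 0` on
  `[0, ½L]` — the printed sentence modulo its symmetry clause (= uniqueness, stage [C]).

The velocity inputs (`u` is `C¹` with `u_x = Q(ω_x)` bounded, `u(t,0) = u(t,½L) = 0`) come from
`ChoiEtAl2017PeriodicHouLuoVelocity.lean` and `…Kernel.lean`.

WHAT THIS IS NOT: not Euler, not Navier–Stokes; no blow-up is asserted — a-priori sign information
for the 1-D periodic wall MODEL. `violates:` none — MODEL.
-/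

noncomputable section

open Set Filter Real MeasureTheory intervalIntegral
open _root_.Topology

namespace Literature.Analysis.FluidPDE

namespace ChoiEtAl2017

/-! ### §1 A transport sign lemma on a rectangle (from the tree's weak maximum principle) -/

/-- **Nonnegativity is preserved by one-dimensional transport with bounded reaction.** On the
rectangle `[0,T] × [a,b]` let `v` (time first: `v t x`) be jointly continuous, with space
derivatives `v_x`, `v_xx` and a left time derivative `v_t` at every point of `(0,T] × (a,b)`,
satisfying the differential inequality `v_t + b·v_x + c·v ≥ 0` there, where `c ≥ −Λ`. If `v ≥ 0`
at `t = 0` and on the lateral sides `x = a`, `x = b`, then `v ≥ 0` on the whole rectangle.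
(The weak maximum principle `Literature.Analysis.PDE.nonpos_of_parabolic_subsolution_1d` with
diffusion coefficient `0`, applied to `w = −e^{−Λt} v`, for which
`w_t + b w_x + (Λ + c) w ≤ 0` and `Λ + c ≥ 0`.) [cite: Lieberman1996, Ch. II Lemma 2.1 and Lemma 2.3 (one space dimension, A = 0)] -/
theorem nonneg_of_transport_supersolution {v vt vx vxx b c : ℝ → ℝ → ℝ} {a₀ b₀ T Λ : ℝ}
    (hv : ContinuousOn (fun p : ℝ × ℝ => v p.1 p.2) (Icc 0 T ×ˢ Icc a₀ b₀))
    (hvx : ∀ t ∈ Ioc 0 T, ∀ x ∈ Ioo a₀ b₀, HasDerivAt (v t) (vx t x) x)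
    (hvxx : ∀ t ∈ Ioc 0 T, ∀ x ∈ Ioo a₀ b₀, HasDerivAt (vx t) (vxx t x) x)
    (hvt : ∀ t ∈ Ioc 0 T, ∀ x ∈ Ioo a₀ b₀, HasDerivWithinAt (fun s => v s x) (vt t x) (Iic t) t)
    (hineq : ∀ t ∈ Ioc 0 T, ∀ x ∈ Ioo a₀ b₀, 0 ≤ vt t x + b t x * vx t x + c t x * v t x)
    (hc : ∀ t ∈ Ioc 0 T, ∀ x ∈ Ioo a₀ b₀, -Λ ≤ c t x)
    (h0 : ∀ x ∈ Icc a₀ b₀, 0 ≤ v 0 x) (ha : ∀ t ∈ Icc 0 T, 0 ≤ v t a₀)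
    (hb : ∀ t ∈ Icc 0 T, 0 ≤ v t b₀) :
    ∀ t ∈ Icc 0 T, ∀ x ∈ Icc a₀ b₀, 0 ≤ v t x := by
  -- the transformed function `w(r, t) = −e^{−Λt} v(t, r)` (space first, as the maximum principle wants)
  set w : ℝ → ℝ → ℝ := fun r t => -(Real.exp (-Λ * t) * v t r) with hw
  set wr : ℝ → ℝ → ℝ := fun r t => -(Real.exp (-Λ * t) * vx t r) with hwr
  set wrr : ℝ → ℝ → ℝ := fun r t => -(Real.exp (-Λ * t) * vxx t r) with hwrr
  set wt : ℝ → ℝ → ℝ := fun r t => -(-Λ * Real.exp (-Λ * t) * v t r + Real.exp (-Λ * t) * vt t r)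
    with hwt
  have hwc : ContinuousOn (fun p : ℝ × ℝ => w p.1 p.2) (Icc a₀ b₀ ×ˢ Icc 0 T) := by
    have hswap : ContinuousOn (fun p : ℝ × ℝ => v p.2 p.1) (Icc a₀ b₀ ×ˢ Icc 0 T) :=
      hv.comp continuous_swap.continuousOn fun p hp => ⟨hp.2, hp.1⟩
    have hexp : ContinuousOn (fun p : ℝ × ℝ => Real.exp (-Λ * p.2)) (Icc a₀ b₀ ×ˢ Icc 0 T) :=
      (Real.continuous_exp.comp (continuous_const.mul continuous_snd)).continuousOn
    exact (hexp.mul hswap).neg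
  have hmp := Literature.Analysis.PDE.nonpos_of_parabolic_subsolution_1d
    (u := w) (ut := wt) (ur := wr) (urr := wrr) (A := fun _ _ => 0) (B := fun r t => -b t r)
    (C := fun r t => Λ + c t r) (a := a₀) (b := b₀) (T := T) hwc ?_ ?_ ?_ ?_ ?_ ?_ ?_ ?_ ?_
  · intro t ht x hx
    have h := hmp x hx t ht
    simp only [hw] at h
    have hexp : 0 < Real.exp (-Λ * t) := Real.exp_pos _
    nlinarith
  · intro r hr t ht
    simp only [hw, hwr]
    exact ((hvx t ht r hr).const_mul _).neg
  · intro r hr t ht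
    simp only [hwr, hwrr]
    exact ((hvxx t ht r hr).const_mul _).neg
  · intro r hr t ht
    simp only [hw, hwt]
    have he : HasDerivAt (fun s => Real.exp (-Λ * s)) (-Λ * Real.exp (-Λ * t)) t := by
      have h := ((hasDerivAt_id t).const_mul (-Λ)).exp
      simpa [mul_comm] using h
    exact ((he.hasDerivWithinAt.mul (hvt t ht r hr))).neg
  · intro r hr t ht; exact le_rfl
  · intro r hr t ht
    have := hc t ht r hr
    show 0 ≤ Λ + c t r
    linarith
  · intro r hr t ht
    simp only [hw, hwt, hwr, hwrr]
    have hexp : 0 < Real.exp (-Λ * t) := Real.exp_pos _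
    have h := hineq t ht r hr
    nlinarith
  · intro r hr
    simp only [hw, mul_zero, Real.exp_zero, one_mul, neg_nonpos]
    exact h0 r hr
  · intro t ht
    simp only [hw, neg_nonpos]
    exact mul_nonneg (Real.exp_pos _).le (ha t ht)
  · intro t ht
    simp only [hw, neg_nonpos]
    exact mul_nonneg (Real.exp_pos _).le (hb t ht)

/-! ### §2 Odd periodic slices vanish at `0` and `½L`; so do their second derivatives' parity constraints -/

/-- An odd function vanishes at `0`. [folklore] -/
private theorem odd_zero {f : ℝ → ℝ} (hodd : ∀ y, f (-y) = -f y) : f 0 = 0 := by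
  have h := hodd 0
  rw [neg_zero] at h
  linarith

/-- An odd `L`-periodic function vanishes at `½L`. [folklore] -/
private theorem odd_periodic_half {f : ℝ → ℝ} {L : ℝ} (hodd : ∀ y, f (-y) = -f y)
    (hper : Function.Periodic f L) : f (L / 2) = 0 := by
  have h1 := hodd (L / 2)
  have h2 := hper (-(L / 2))
  rw [show -(L / 2) + L = L / 2 by ring] at h2
  linarith

/-! ### §3 The HL model: `θ_x ≥ 0` and `ω ≥ 0` on `[0, ½L]` persist (p. 11) -/

/-- **`θ_x ≥ 0` on `[0, ½L]` is preserved** (CHKLSY p. 11 "the evolution preserves the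
assumptions … `θ_x ≥ 0` on `[0, ½L]`"), for a classical `L`-periodic HL solution on `[0,T']`
(`T' > 0`, any `T' < T` of `IsPeriodicHouLuoSolution`) whose slices keep the printed symmetry —
`ω(t)` odd, `θ_x(t)` odd — and whose `θ_x` is jointly continuous on `[0,T'] × [0, ½L]`, has slices
`θ(t) ∈ C³`, `ω(t) ∈ C¹` with `|ω_x| ≤ M`, and satisfies the differentiated transport equation
`(θ_x)_t = −(u θ_xx + u_x θ_x)` (`u = Qω(t)`, `u_x = Q(ω_x(t))`) as a left time derivative on
`(0,T'] × (0, ½L)`. Then `θ_{0x} ≥ 0` on `[0, ½L]` implies `θ_x(t,·) ≥ 0` on `[0, ½L]` for all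
`t ∈ [0,T']`. (Transport sign lemma with `b = u`, `c = u_x ≥ −(M/π)Λ_L`; the lateral values
`θ_x(t,0) = θ_x(t,½L) = 0` come from oddness and periodicity.)
[cite: ChoiHouKiselevLuoSverakYao2017, §4 p. 11 (the evolution preserves θ_x ≥ 0 on [0, ½L])] -/
theorem deriv_theta_nonneg_of_symmetric {L T : ℝ} (hL : 0 < L) {ω θ : ℝ → ℝ → ℝ}
    {θxt : ℝ → ℝ → ℝ} {M : ℝ}
    (hωC1 : ∀ t ∈ Icc 0 T, ContDiff ℝ 1 (ω t)) (hωper : ∀ t ∈ Icc 0 T, Function.Periodic (ω t) L)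
    (hM : ∀ t ∈ Icc 0 T, ∀ x, |deriv (ω t) x| ≤ M)
    (hθC3 : ∀ t ∈ Icc 0 T, ContDiff ℝ 3 (θ t)) (hθper : ∀ t ∈ Icc 0 T, Function.Periodic (θ t) L)
    (hθxodd : ∀ t ∈ Icc 0 T, ∀ y, deriv (θ t) (-y) = -deriv (θ t) y)
    (hθx_cont : ContinuousOn (fun p : ℝ × ℝ => deriv (θ p.1) p.2) (Icc 0 T ×ˢ Icc 0 (L / 2)))
    (hθxt : ∀ t ∈ Ioc 0 T, ∀ x ∈ Ioo 0 (L / 2),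
      HasDerivWithinAt (fun s => deriv (θ s) x) (θxt t x) (Iic t) t)
    (heq : ∀ t ∈ Ioc 0 T, ∀ x ∈ Ioo 0 (L / 2),
      θxt t x = -(periodicHLVelocity L (ω t) x * deriv (deriv (θ t)) x +
        deriv (periodicHLVelocity L (ω t)) x * deriv (θ t) x))
    (h0 : ∀ x ∈ Icc 0 (L / 2), 0 ≤ deriv (θ 0) x) :
    ∀ t ∈ Icc 0 T, ∀ x ∈ Icc 0 (L / 2), 0 ≤ deriv (θ t) x := by
  -- the reaction coefficient `c = u_x` is bounded below by `−(M/π)Λ_L`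
  set Λ : ℝ := M / π * ∫ z in (0 : ℝ)..L, |(Real.log |Real.sin (π * z / L)|)| with hΛ
  refine nonneg_of_transport_supersolution (v := fun t x => deriv (θ t) x) (vt := θxt)
    (vx := fun t x => deriv (deriv (θ t)) x) (vxx := fun t x => deriv (deriv (deriv (θ t))) x)
    (b := fun t x => periodicHLVelocity L (ω t) x)
    (c := fun t x => deriv (periodicHLVelocity L (ω t)) x) (Λ := Λ)
    hθx_cont ?_ ?_ hθxt ?_ ?_ h0 ?_ ?_
  · intro t ht x _
    have h3 := hθC3 t ⟨ht.1.le, ht.2⟩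
    have hd : ContDiff ℝ 2 (deriv (θ t)) := by
      have := (contDiff_succ_iff_deriv.1 (show ContDiff ℝ ((2 : ℕ) + 1) (θ t) by exact_mod_cast h3)).2.2
      exact_mod_cast this
    exact (hd.differentiable (by norm_num)).differentiableAt.hasDerivAt
  · intro t ht x _
    have h3 := hθC3 t ⟨ht.1.le, ht.2⟩
    have hd : ContDiff ℝ 2 (deriv (θ t)) := by
      have := (contDiff_succ_iff_deriv.1 (show ContDiff ℝ ((2 : ℕ) + 1) (θ t) by exact_mod_cast h3)).2.2
      exact_mod_cast this
    have hdd : ContDiff ℝ 1 (deriv (deriv (θ t))) := by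
      have := (contDiff_succ_iff_deriv.1 (show ContDiff ℝ ((1 : ℕ) + 1) (deriv (θ t)) by exact_mod_cast hd)).2.2
      exact_mod_cast this
    exact (hdd.differentiable (by norm_num)).differentiableAt.hasDerivAt
  · intro t ht x hx
    rw [heq t ht x hx]
    linarith
  · intro t ht x _
    have ht' : t ∈ Icc 0 T := ⟨ht.1.le, ht.2⟩
    have h := abs_deriv_periodicHLVelocity_le hL (hωC1 t ht') (hωper t ht') (hM t ht') x
    rw [← hΛ] at h
    linarith [neg_abs_le (deriv (periodicHLVelocity L (ω t)) x)]
  · intro t ht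
    exact (odd_zero (hθxodd t ht)).symm.le
  · intro t ht
    have hper' : Function.Periodic (deriv (θ t)) L := by
      intro y
      have h : (fun z => θ t (z + L)) = θ t := funext fun z => hθper t ht z
      rw [← deriv_comp_add_const, h]
    exact (odd_periodic_half (hθxodd t ht) hper').symm.le

/-- **`ω ≥ 0` on `[0, ½L]` is preserved** (CHKLSY p. 11), for a classical `L`-periodic HL solution
on `[0,T')` (`IsPeriodicHouLuoSolution L ω θ T'`) with `T < T'`, whose slices keep the printed
symmetry (`ω(t)` odd), with `ω` jointly continuous on `[0,T] × [0, ½L]`, slices `ω(t) ∈ C²`, and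
`θ_x(t) ≥ 0` on `(0, ½L)` for `t ∈ (0,T]` (the previous theorem): `ω₀ ≥ 0` on `[0, ½L]` implies
`ω(t,·) ≥ 0` on `[0, ½L]` for all `t ∈ [0,T]`. (The vorticity equation `ω_t + uω_x = θ_x ≥ 0` is a
transport supersolution with `c = 0`; lateral values `ω(t,0) = ω(t,½L) = 0` by oddness and
periodicity.) [cite: ChoiHouKiselevLuoSverakYao2017, §4 p. 11 (the evolution preserves ω ≥ 0 on [0, ½L])] -/
theorem omega_nonneg_of_symmetric {L T T' : ℝ} (hTT' : T < T') {ω θ : ℝ → ℝ → ℝ}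
    (hsol : IsPeriodicHouLuoSolution L ω θ T')
    (hωC2 : ∀ t ∈ Icc 0 T, ContDiff ℝ 2 (ω t))
    (hωodd : ∀ t ∈ Icc 0 T, ∀ y, ω t (-y) = -ω t y)
    (hω_cont : ContinuousOn (fun p : ℝ × ℝ => ω p.1 p.2) (Icc 0 T ×ˢ Icc 0 (L / 2)))
    (hθx : ∀ t ∈ Ioc 0 T, ∀ x ∈ Ioo 0 (L / 2), 0 ≤ deriv (θ t) x)
    (h0 : ∀ x ∈ Icc 0 (L / 2), 0 ≤ ω 0 x) :
    ∀ t ∈ Icc 0 T, ∀ x ∈ Icc 0 (L / 2), 0 ≤ ω t x := by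
  refine nonneg_of_transport_supersolution (v := ω)
    (vt := fun t x => -(periodicHLVelocity L (ω t) x * deriv (ω t) x) + deriv (θ t) x)
    (vx := fun t x => deriv (ω t) x) (vxx := fun t x => deriv (deriv (ω t)) x)
    (b := fun t x => periodicHLVelocity L (ω t) x) (c := fun _ _ => 0) (Λ := 0)
    hω_cont ?_ ?_ ?_ ?_ ?_ h0 ?_ ?_
  · intro t ht x _
    exact ((hωC2 t ⟨ht.1.le, ht.2⟩).differentiable (by norm_num)).differentiableAt.hasDerivAt
  · intro t ht x _
    have h2 := hωC2 t ⟨ht.1.le, ht.2⟩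
    have hd : ContDiff ℝ 1 (deriv (ω t)) := by
      have := (contDiff_succ_iff_deriv.1 (show ContDiff ℝ ((1 : ℕ) + 1) (ω t) by exact_mod_cast h2)).2.2
      exact_mod_cast this
    exact (hd.differentiable (by norm_num)).differentiableAt.hasDerivAt
  · intro t ht x _
    have htt : t ∈ Ioo 0 T' := ⟨ht.1, lt_of_le_of_lt ht.2 hTT'⟩
    exact ((hsol.2.2 t htt x).1).hasDerivWithinAt
  · intro t ht x hx
    have h := hθx t ht x hx
    simp only [zero_mul, add_zero]
    linarith
  · intro t _ x _; norm_num
  · intro t ht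
    exact (odd_zero (hωodd t ht)).symm.le
  · intro t ht
    have htt : t ∈ Ico 0 T' := ⟨ht.1, lt_of_le_of_lt ht.2 hTT'⟩
    exact (odd_periodic_half (hωodd t ht) (hsol.1 t htt).2.2.1).symm.le

/-- **The inflow persists: `u(t) ≤ 0` on `[0, ½L]`** for every `t ∈ [0,T]`, once `ω(t) ≥ 0` on
`[0, ½L]` (previous theorem) and `ω(t)` is continuous, odd and `L`-periodic — p. 11 "(−u) ≥ 0 on
`[0, ½L]`" along the evolution; by `periodicHLVelocity_nonpos` (Lemma 6).
[cite: ChoiHouKiselevLuoSverakYao2017, §4 p. 11 (the evolution preserves (−u) ≥ 0 on [0, ½L])] -/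
theorem periodicHLVelocity_nonpos_of_symmetric {L T : ℝ} (hL : 0 < L) {ω : ℝ → ℝ → ℝ}
    (hωc : ∀ t ∈ Icc 0 T, Continuous (ω t)) (hωodd : ∀ t ∈ Icc 0 T, ∀ y, ω t (-y) = -ω t y)
    (hωper : ∀ t ∈ Icc 0 T, Function.Periodic (ω t) L)
    (hnn : ∀ t ∈ Icc 0 T, ∀ x ∈ Icc 0 (L / 2), 0 ≤ ω t x) :
    ∀ t ∈ Icc 0 T, ∀ x ∈ Icc 0 (L / 2), periodicHLVelocity L (ω t) x ≤ 0 :=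
  fun t ht _ hx => periodicHLVelocity_nonpos hL (hωc t ht) (hωodd t ht) (hωper t ht) (hnn t ht) hx

/-! ### §4 From joint smoothness: partial derivatives, mixed partials, the `θ_x`-equation -/

/-- The `x`-slice derivative of a jointly differentiable `Θ : ℝ × ℝ → ℝ` is the partial derivative
`DΘ(p)(0,1)`. [folklore] -/
private theorem hasDerivAt_slice_snd {Θ : ℝ × ℝ → ℝ} {p : ℝ × ℝ} (h : DifferentiableAt ℝ Θ p) :
    HasDerivAt (fun x => Θ (p.1, x)) (fderiv ℝ Θ p ((0 : ℝ), (1 : ℝ))) p.2 := by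
  have hι : HasDerivAt (fun x : ℝ => (p.1, x)) ((0 : ℝ), (1 : ℝ)) p.2 :=
    (hasDerivAt_const p.2 p.1).prodMk (hasDerivAt_id p.2)
  have := h.hasFDerivAt.comp_hasDerivAt p.2 hι
  simpa [Function.comp_def] using this

/-- The `t`-slice derivative of a jointly differentiable `Θ : ℝ × ℝ → ℝ` is the partial derivative
`DΘ(p)(1,0)`. [folklore] -/
private theorem hasDerivAt_slice_fst {Θ : ℝ × ℝ → ℝ} {p : ℝ × ℝ} (h : DifferentiableAt ℝ Θ p) :
    HasDerivAt (fun t => Θ (t, p.2)) (fderiv ℝ Θ p ((1 : ℝ), (0 : ℝ))) p.1 := by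
  have hι : HasDerivAt (fun t : ℝ => (t, p.2)) ((1 : ℝ), (0 : ℝ)) p.1 :=
    (hasDerivAt_id p.1).prodMk (hasDerivAt_const p.1 p.2)
  have := h.hasFDerivAt.comp_hasDerivAt p.1 hι
  simpa [Function.comp_def] using this

/-- For `Θ ∈ C²` near `p`: the `t`-derivative of the partial derivative `q ↦ DΘ(q)v` along the
`t`-slice is `D²Θ(p)(1,0)(v)`. [folklore] -/
private theorem hasDerivAt_fderiv_apply_fst {Θ : ℝ × ℝ → ℝ} {p : ℝ × ℝ} (h : ContDiffAt ℝ 2 Θ p)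
    (v : ℝ × ℝ) :
    HasDerivAt (fun t => fderiv ℝ Θ (t, p.2) v)
      ((fderiv ℝ (fderiv ℝ Θ) p ((1 : ℝ), (0 : ℝ))) v) p.1 := by
  have hd : DifferentiableAt ℝ (fderiv ℝ Θ) p :=
    (h.fderiv_right (m := 1) (by norm_num)).differentiableAt (by norm_num)
  have hι : HasDerivAt (fun t : ℝ => (t, p.2)) ((1 : ℝ), (0 : ℝ)) p.1 :=
    (hasDerivAt_id p.1).prodMk (hasDerivAt_const p.1 p.2)
  have h1 : HasDerivAt (fun t => fderiv ℝ Θ (t, p.2))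
      (fderiv ℝ (fderiv ℝ Θ) p ((1 : ℝ), (0 : ℝ))) p.1 := by
    have := hd.hasFDerivAt.comp_hasDerivAt p.1 hι
    simpa [Function.comp_def] using this
  exact h1.clm_apply (hasDerivAt_const p.1 v) |>.congr_deriv (by simp)

/-- Same along the `x`-slice: `d/dx DΘ(t,x)v = D²Θ(p)(0,1)(v)`. [folklore] -/
private theorem hasDerivAt_fderiv_apply_snd {Θ : ℝ × ℝ → ℝ} {p : ℝ × ℝ} (h : ContDiffAt ℝ 2 Θ p)
    (v : ℝ × ℝ) :
    HasDerivAt (fun x => fderiv ℝ Θ (p.1, x) v)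
      ((fderiv ℝ (fderiv ℝ Θ) p ((0 : ℝ), (1 : ℝ))) v) p.2 := by
  have hd : DifferentiableAt ℝ (fderiv ℝ Θ) p :=
    (h.fderiv_right (m := 1) (by norm_num)).differentiableAt (by norm_num)
  have hι : HasDerivAt (fun x : ℝ => (p.1, x)) ((0 : ℝ), (1 : ℝ)) p.2 :=
    (hasDerivAt_const p.2 p.1).prodMk (hasDerivAt_id p.2)
  have h1 : HasDerivAt (fun x => fderiv ℝ Θ (p.1, x))
      (fderiv ℝ (fderiv ℝ Θ) p ((0 : ℝ), (1 : ℝ))) p.2 := by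
    have := hd.hasFDerivAt.comp_hasDerivAt p.2 hι
    simpa [Function.comp_def] using this
  exact h1.clm_apply (hasDerivAt_const p.2 v) |>.congr_deriv (by simp)

/-- **The differentiated transport equation for `θ_x`** from joint `C²` smoothness: for a classical
periodic HL solution on `[0,T')` (`L > 0`) whose `θ` is jointly `C²` on the open strip
`(0,T') × ℝ` and whose vorticity slices are `C¹`, at every `t ∈ (0,T')` and every `x`,
`∂_t(θ_x)(t,x) = −(u θ_xx + u_x θ_x)(t,x)`, `u = Qω(t)` — i.e. `θ_{xt} = (θ_t)_x = (−uθ_x)_x`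
(symmetry of second derivatives; `u ∈ C¹` with `u_x = Q(ω_x)` from `…Velocity.lean`).
[cite: ChoiHouKiselevLuoSverakYao2017, §4 p. 11 (transport structure of (hl): the θ_x-equation)] -/
theorem hasDerivAt_deriv_theta {L T' : ℝ} (hL : 0 < L) {ω θ : ℝ → ℝ → ℝ}
    (hsol : IsPeriodicHouLuoSolution L ω θ T')
    (hθ2 : ContDiffOn ℝ 2 (fun p : ℝ × ℝ => θ p.1 p.2) (Ioo 0 T' ×ˢ univ))
    (hω1 : ∀ t ∈ Ioo 0 T', ContDiff ℝ 1 (ω t)) {t : ℝ} (ht : t ∈ Ioo 0 T') (x : ℝ) :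
    HasDerivAt (fun s => deriv (θ s) x)
      (-(periodicHLVelocity L (ω t) x * deriv (deriv (θ t)) x +
        deriv (periodicHLVelocity L (ω t)) x * deriv (θ t) x)) t := by
  set Θ : ℝ × ℝ → ℝ := fun p => θ p.1 p.2 with hΘ
  have hS : IsOpen (Ioo (0 : ℝ) T' ×ˢ (univ : Set ℝ)) := isOpen_Ioo.prod isOpen_univ
  have hC2 : ∀ q : ℝ × ℝ, q.1 ∈ Ioo 0 T' → ContDiffAt ℝ 2 Θ q := fun q hq =>
    hθ2.contDiffAt (hS.mem_nhds ⟨hq, mem_univ _⟩)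
  have hD : ∀ q : ℝ × ℝ, q.1 ∈ Ioo 0 T' → DifferentiableAt ℝ Θ q := fun q hq =>
    (hC2 q hq).differentiableAt (by norm_num)
  -- (1) slice derivatives are partial derivatives
  have hx_eq : ∀ s ∈ Ioo 0 T', ∀ y, deriv (θ s) y = fderiv ℝ Θ (s, y) ((0 : ℝ), (1 : ℝ)) :=
    fun s hs y => (hasDerivAt_slice_snd (p := (s, y)) (hD _ hs)).deriv
  have ht_eq : ∀ s ∈ Ioo 0 T', ∀ y, fderiv ℝ Θ (s, y) ((1 : ℝ), (0 : ℝ)) =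
      -(periodicHLVelocity L (ω s) y * deriv (θ s) y) := by
    intro s hs y
    have h1 := hasDerivAt_slice_fst (p := (s, y)) (hD _ hs)
    have h2 := (hsol.2.2 s hs y).2
    exact h1.unique h2
  -- (2) `∂_t θ_x` exists and equals the mixed partial `D²Θ(p)(1,0)(0,1)`
  have hp : ContDiffAt ℝ 2 Θ (t, x) := hC2 (t, x) ht
  have hmix := hasDerivAt_fderiv_apply_fst (p := (t, x)) hp ((0 : ℝ), (1 : ℝ))
  have hmix' : HasDerivAt (fun s => deriv (θ s) x)
      ((fderiv ℝ (fderiv ℝ Θ) (t, x) ((1 : ℝ), (0 : ℝ))) ((0 : ℝ), (1 : ℝ))) t := by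
    refine hmix.congr_of_eventuallyEq ?_
    filter_upwards [isOpen_Ioo.mem_nhds ht] with s hs
    exact hx_eq s hs x
  -- (3) symmetry of the second derivative and the `x`-derivative of `θ_t = −uθ_x`
  have hsymm : (fderiv ℝ (fderiv ℝ Θ) (t, x) ((1 : ℝ), (0 : ℝ))) ((0 : ℝ), (1 : ℝ)) =
      (fderiv ℝ (fderiv ℝ Θ) (t, x) ((0 : ℝ), (1 : ℝ))) ((1 : ℝ), (0 : ℝ)) :=
    (hp.isSymmSndFDerivAt (by simp)) _ _
  have hmix2 := hasDerivAt_fderiv_apply_snd (p := (t, x)) hp ((1 : ℝ), (0 : ℝ))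
  -- the same slice function written as `y ↦ −u(t,y) θ_x(t,y)`
  have hper : Function.Periodic (ω t) L := (hsol.1 t ⟨ht.1.le, ht.2⟩).2.2.1
  have hθC2 : ContDiff ℝ 2 (θ t) := (hsol.1 t ⟨ht.1.le, ht.2⟩).2.1
  have hu : HasDerivAt (periodicHLVelocity L (ω t)) (deriv (periodicHLVelocity L (ω t)) x) x := by
    have h := hasDerivAt_periodicHLVelocity hL (hω1 t ht) hper x
    rwa [← deriv_periodicHLVelocity hL (hω1 t ht) hper] at h
  have hθx : HasDerivAt (deriv (θ t)) (deriv (deriv (θ t)) x) x := by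
    have hd : ContDiff ℝ 1 (deriv (θ t)) := by
      have := (contDiff_succ_iff_deriv.1
        (show ContDiff ℝ ((1 : ℕ) + 1) (θ t) by exact_mod_cast hθC2)).2.2
      exact_mod_cast this
    exact (hd.differentiable (by norm_num)).differentiableAt.hasDerivAt
  have hprod : HasDerivAt (fun y => -(periodicHLVelocity L (ω t) y * deriv (θ t) y))
      (-(deriv (periodicHLVelocity L (ω t)) x * deriv (θ t) x +
        periodicHLVelocity L (ω t) x * deriv (deriv (θ t)) x)) x := (hu.mul hθx).neg
  have hmix2' : HasDerivAt (fun y => -(periodicHLVelocity L (ω t) y * deriv (θ t) y))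
      ((fderiv ℝ (fderiv ℝ Θ) (t, x) ((0 : ℝ), (1 : ℝ))) ((1 : ℝ), (0 : ℝ))) x := by
    refine hmix2.congr_of_eventuallyEq (Eventually.of_forall fun y => ?_)
    exact (ht_eq t ht y).symm
  have hval : (fderiv ℝ (fderiv ℝ Θ) (t, x) ((0 : ℝ), (1 : ℝ))) ((1 : ℝ), (0 : ℝ)) =
      -(deriv (periodicHLVelocity L (ω t)) x * deriv (θ t) x +
        periodicHLVelocity L (ω t) x * deriv (deriv (θ t)) x) := hmix2'.unique hprod
  refine hmix'.congr_deriv ?_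
  rw [hsymm, hval]
  ring

/-! ### §5 From joint smoothness on the closed half-plane: continuity of `θ_x`, bounds, smooth slices -/

/-- The closed half-plane `{t ≥ 0}` as a product set. [folklore] -/
private theorem halfPlane_eq : {p : ℝ × ℝ | 0 ≤ p.1} = Ici (0 : ℝ) ×ˢ (univ : Set ℝ) := by
  ext p; simp

/-- On the closed half-plane `U = {t ≥ 0}`, a jointly `C¹` function `Θ(t,x) = θ t x` has
`x`-slice derivative `deriv (θ t) x = D_UΘ(t,x)(0,1)` (the within-derivative), at EVERY point of `U`
including `t = 0`. [folklore] -/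
private theorem deriv_slice_eq_fderivWithin {θ : ℝ → ℝ → ℝ}
    (hθ : ContDiffOn ℝ 1 (fun p : ℝ × ℝ => θ p.1 p.2) {p : ℝ × ℝ | 0 ≤ p.1}) {p : ℝ × ℝ}
    (hp : 0 ≤ p.1) :
    deriv (θ p.1) p.2 =
      fderivWithin ℝ (fun p : ℝ × ℝ => θ p.1 p.2) {p : ℝ × ℝ | 0 ≤ p.1} p ((0 : ℝ), (1 : ℝ)) := by
  have hd := (hθ.differentiableOn (by norm_num) p hp).hasFDerivWithinAt
  have hι : HasDerivWithinAt (fun x : ℝ => (p.1, x)) ((0 : ℝ), (1 : ℝ)) univ p.2 :=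
    ((hasDerivAt_const p.2 p.1).prodMk (hasDerivAt_id p.2)).hasDerivWithinAt
  have hmaps : MapsTo (fun x : ℝ => (p.1, x)) univ {p : ℝ × ℝ | 0 ≤ p.1} := fun x _ => hp
  have h := hd.comp_hasDerivWithinAt p.2 hι hmaps
  have h' : HasDerivAt (fun x : ℝ => θ p.1 x)
      (fderivWithin ℝ (fun p : ℝ × ℝ => θ p.1 p.2) {p : ℝ × ℝ | 0 ≤ p.1} p ((0 : ℝ), (1 : ℝ)))
      p.2 := h.hasDerivAt univ_mem
  exact h'.deriv

/-- **Joint continuity of `θ_x` up to `t = 0`**: if `(t,x) ↦ θ t x` is jointly `C¹` on the closed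
half-plane `{t ≥ 0}` (the smoothness clause of `IsGlobalSmoothPeriodicHouLuoSolution`), then
`(t,x) ↦ θ_x(t,x)` is continuous there. [folklore] -/
private theorem continuousOn_deriv_slice {θ : ℝ → ℝ → ℝ}
    (hθ : ContDiffOn ℝ 1 (fun p : ℝ × ℝ => θ p.1 p.2) {p : ℝ × ℝ | 0 ≤ p.1}) :
    ContinuousOn (fun p : ℝ × ℝ => deriv (θ p.1) p.2) {p : ℝ × ℝ | 0 ≤ p.1} := by
  have hU : UniqueDiffOn ℝ {p : ℝ × ℝ | 0 ≤ p.1} := by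
    rw [halfPlane_eq]
    exact (uniqueDiffOn_Ici 0).prod uniqueDiffOn_univ
  have hc := hθ.continuousOn_fderivWithin hU le_rfl
  have hc' : ContinuousOn (fun p : ℝ × ℝ =>
      fderivWithin ℝ (fun p : ℝ × ℝ => θ p.1 p.2) {p : ℝ × ℝ | 0 ≤ p.1} p ((0 : ℝ), (1 : ℝ)))
      {p : ℝ × ℝ | 0 ≤ p.1} :=
    hc.clm_apply continuousOn_const
  exact hc'.congr fun p hp => deriv_slice_eq_fderivWithin hθ hp

/-- Slices of a jointly `Cⁿ` function on the closed half-plane are `Cⁿ` (for `t ≥ 0`). [folklore] -/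
private theorem contDiff_slice {θ : ℝ → ℝ → ℝ} {n : WithTop ℕ∞}
    (hθ : ContDiffOn ℝ n (fun p : ℝ × ℝ => θ p.1 p.2) {p : ℝ × ℝ | 0 ≤ p.1}) {t : ℝ} (ht : 0 ≤ t) :
    ContDiff ℝ n (θ t) := by
  have hι : ContDiff ℝ n (fun x : ℝ => (t, x)) := contDiff_const.prodMk contDiff_id
  exact hθ.comp_contDiff hι fun _ => ht

/-- **A uniform bound on `ω_x`** on `[0,T] × ℝ` for a jointly `C¹` vorticity with `L`-periodic slices
(`L > 0`): continuity on the compact `[0,T] × [0,L]` and periodicity. [folklore] -/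
private theorem exists_bound_deriv_slice {ω : ℝ → ℝ → ℝ} {L T : ℝ} (hL : 0 < L)
    (hω : ContDiffOn ℝ 1 (fun p : ℝ × ℝ => ω p.1 p.2) {p : ℝ × ℝ | 0 ≤ p.1})
    (hper : ∀ t ∈ Icc 0 T, Function.Periodic (ω t) L) :
    ∃ M : ℝ, ∀ t ∈ Icc 0 T, ∀ x, |deriv (ω t) x| ≤ M := by
  have hcont := (continuousOn_deriv_slice hω).mono
    (show Icc (0 : ℝ) T ×ˢ Icc (0 : ℝ) L ⊆ {p : ℝ × ℝ | 0 ≤ p.1} from fun p hp => hp.1.1)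
  obtain ⟨C, hC⟩ := (isCompact_Icc.prod isCompact_Icc).exists_bound_of_continuousOn hcont
  refine ⟨C, fun t ht x => ?_⟩
  have hperd : Function.Periodic (deriv (ω t)) L := by
    intro y
    have h : (fun z => ω t (z + L)) = ω t := funext fun z => hper t ht z
    rw [← deriv_comp_add_const, h]
  obtain ⟨y, hy, hxy⟩ := hperd.exists_mem_Ico₀ hL x
  rw [hxy]
  have h := hC (t, y) ⟨ht, ⟨hy.1, hy.2.le⟩⟩
  rwa [Real.norm_eq_abs] at h

/-! ### §6 Assembly: the sign structure persists for smooth symmetric solutions -/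

/-- **CHKLSY p. 11, the sign half of "the evolution preserves the assumptions"**, kernel-checked for
smooth solutions that keep the printed symmetry. Let `L > 0`, `0 ≤ T < T'`, and let `(ω, θ)` be a
classical `L`-periodic HL solution on `[0,T')` (`IsPeriodicHouLuoSolution L ω θ T'`, `T < T'`) which is
jointly `C^∞` on the closed half-plane `{t ≥ 0}` (the smoothness clause of
`IsGlobalSmoothPeriodicHouLuoSolution`) and whose slices stay odd: `ω(t)` odd and `θ_x(t)` odd for
`t ∈ [0,T]`. If `θ_{0x} ≥ 0` and `ω₀ ≥ 0` on `[0, ½L]`, then for every `t ∈ [0,T]` and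
`x ∈ [0, ½L]`: `θ_x(t,x) ≥ 0`, `ω(t,x) ≥ 0` and `u(t,x) = Qω(t)(x) ≤ 0`.
(The symmetry hypothesis is what uniqueness — local well-posedness, p. 6 — supplies in print; it is
the remaining stage of the discharge of `choiEtAl2017_periodicHouLuo_blowup`.)
[cite: ChoiHouKiselevLuoSverakYao2017, §4 p. 11 (the evolution preserves θ_x, ω, (−u) ≥ 0 on [0, ½L])] -/
theorem sign_persistence_of_symmetric {L T T' : ℝ} (hL : 0 < L) (hTT' : T < T')
    {ω θ : ℝ → ℝ → ℝ} (hsol : IsPeriodicHouLuoSolution L ω θ T')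
    (hθs : ContDiffOn ℝ (⊤ : ℕ∞) (fun p : ℝ × ℝ => θ p.1 p.2) {p : ℝ × ℝ | 0 ≤ p.1})
    (hωs : ContDiffOn ℝ (⊤ : ℕ∞) (fun p : ℝ × ℝ => ω p.1 p.2) {p : ℝ × ℝ | 0 ≤ p.1})
    (hωodd : ∀ t ∈ Icc 0 T, ∀ y, ω t (-y) = -ω t y)
    (hθxodd : ∀ t ∈ Icc 0 T, ∀ y, deriv (θ t) (-y) = -deriv (θ t) y)
    (h0θ : ∀ x ∈ Icc 0 (L / 2), 0 ≤ deriv (θ 0) x) (h0ω : ∀ x ∈ Icc 0 (L / 2), 0 ≤ ω 0 x) :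
    ∀ t ∈ Icc 0 T, ∀ x ∈ Icc 0 (L / 2),
      0 ≤ deriv (θ t) x ∧ 0 ≤ ω t x ∧ periodicHLVelocity L (ω t) x ≤ 0 := by
  -- bookkeeping from the hypotheses
  have hIccT : ∀ t ∈ Icc 0 T, t ∈ Ico 0 T' := fun t ht => ⟨ht.1, lt_of_le_of_lt ht.2 hTT'⟩
  have hωper : ∀ t ∈ Icc 0 T, Function.Periodic (ω t) L := fun t ht => (hsol.1 t (hIccT t ht)).2.2.1
  have hθper : ∀ t ∈ Icc 0 T, Function.Periodic (θ t) L := fun t ht => (hsol.1 t (hIccT t ht)).2.2.2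
  have hθs1 : ContDiffOn ℝ 1 (fun p : ℝ × ℝ => θ p.1 p.2) {p : ℝ × ℝ | 0 ≤ p.1} :=
    hθs.of_le (by exact_mod_cast (le_top : (1 : ℕ∞) ≤ ⊤))
  have hωs1 : ContDiffOn ℝ 1 (fun p : ℝ × ℝ => ω p.1 p.2) {p : ℝ × ℝ | 0 ≤ p.1} :=
    hωs.of_le (by exact_mod_cast (le_top : (1 : ℕ∞) ≤ ⊤))
  have hθC3 : ∀ t ∈ Icc 0 T, ContDiff ℝ 3 (θ t) := fun t ht =>
    (contDiff_infty.1 (contDiff_slice hθs ht.1)) 3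
  have hωC2 : ∀ t ∈ Icc 0 T, ContDiff ℝ 2 (ω t) := fun t ht =>
    (contDiff_infty.1 (contDiff_slice hωs ht.1)) 2
  have hωC1 : ∀ t ∈ Icc 0 T, ContDiff ℝ 1 (ω t) := fun t ht => (hωC2 t ht).of_le (by norm_num)
  obtain ⟨M, hM⟩ := exists_bound_deriv_slice (T := T) hL hωs1 hωper
  -- continuity of `θ_x` and `ω` on the closed rectangle
  have hθx_cont : ContinuousOn (fun p : ℝ × ℝ => deriv (θ p.1) p.2) (Icc 0 T ×ˢ Icc 0 (L / 2)) :=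
    (continuousOn_deriv_slice hθs1).mono fun p hp => hp.1.1
  have hω_cont : ContinuousOn (fun p : ℝ × ℝ => ω p.1 p.2) (Icc 0 T ×ˢ Icc 0 (L / 2)) :=
    hωs.continuousOn.mono fun p hp => hp.1.1
  -- the `θ_x`-equation on the open strip, from joint smoothness
  have hθ2 : ContDiffOn ℝ 2 (fun p : ℝ × ℝ => θ p.1 p.2) (Ioo 0 T' ×ˢ univ) :=
    ((contDiffOn_infty.1 hθs) 2).mono fun p hp => hp.1.1.le
  have hω1' : ∀ t ∈ Ioo 0 T', ContDiff ℝ 1 (ω t) := fun t ht =>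
    (contDiff_infty.1 (contDiff_slice hωs ht.1.le)) 1
  have hθx := deriv_theta_nonneg_of_symmetric (T := T) hL hωC1 hωper hM hθC3 hθper hθxodd hθx_cont
    (θxt := fun t x => -(periodicHLVelocity L (ω t) x * deriv (deriv (θ t)) x +
        deriv (periodicHLVelocity L (ω t)) x * deriv (θ t) x))
    (fun t ht x _ => (hasDerivAt_deriv_theta hL hsol hθ2 hω1'
      ⟨ht.1, lt_of_le_of_lt ht.2 hTT'⟩ x).hasDerivWithinAt)
    (fun t _ x _ => rfl) h0θ
  have hω := omega_nonneg_of_symmetric hTT' hsol hωC2 hωodd hω_cont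
    (fun t ht x hx => hθx t ⟨ht.1.le, ht.2⟩ x ⟨hx.1.le, hx.2.le⟩) h0ω
  have hu := periodicHLVelocity_nonpos_of_symmetric (T := T) hL
    (fun t ht => (hωC1 t ht).continuous) hωodd hωper hω
  exact fun t ht x hx => ⟨hθx t ht x hx, hω t ht x hx, hu t ht x hx⟩

end ChoiEtAl2017

end Literature.Analysis.FluidPDE
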